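import Summits.BirchSwinnertonDyer.BirchSwinnertonDyer.Theorems.SignedLowerHalvesSmallImageLowerHalfBothSignsRttD2TwistTower
import Summits.BirchSwinnertonDyer.BirchSwinnertonDyer.Theorems.SignedLowerHalvesSmallImageLowerHalfBothSignsRttD2TwistLevelInverse
import HarnessLib

/-!
# Route `SignedLowerHalves`, crux L `SmallImageLowerHalfBothSigns` (stmt-BirchSwinnertonDyer-23599), line `rtt_w3` v14 — E2, row «D-tw-coh» part 2c(ii):
# the ASSEMBLED twist `Tw : H^i(𝒪_K[1/p𝔣], Λ_𝒪(θ)(1)) ≃+ H^i(𝒪_K[1/p𝔣], Λ_𝒪(θ')(1))` on the pinned data and its SEMILINEARITY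

INPUTS hand `bsd-inputs-honda-p1` g23 (LEAD g11 RULING «U» (U5): `θ := χ₀`, `θ' := θ* = χ₀·η`, `η ≡ 1 (mod p^k)` on `Gal(K̄/K̃_{m(k)})`). For pinned data
`D : IwasawaCohomologyDataO … γ₁ γ₂ θ 𝔣 i`, `D' : IwasawaCohomologyDataO … γ₁' γ₂' θ' 𝔣 i` (same tower `κ₁, κ₂`; ANY pins `γ`; the module form of the `T_i`-semilinearity for the same `γ₁, γ₂`), congruences `hN` (on `N_S`, all `k`) and `hm`
(on the layers `m k`, `m` monotone):
* ★★★ `twistHom … D D' : D.H →+ D'.H` — through (P4)/(P3) of `D'` applied to the twisted family of part 2c(i); ★★ `proj_twistHom` — on the cofinal range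
  `n ≥ m(k)` its level-`(n,k)` component is the layer twist `tw_n` of the level-`(n,k)` component (and `proj_twistHom_eq` at any auxiliary level);
  ★ `twistHom_unique` — it is the only additive map with this property (cofinal injectivity).
* ★★ `twistHom_C_C_smul` — `Tw` is `𝒪`-linear; `proj_twistHom_X_smul`/`proj_twistHom_C_X_smul` — the `T_i`-twist read levelwise (any `γ'`); ★★★ `twistHom_X_smul`,
  `twistHom_C_X_smul` — **`Tw` is `Λ_{𝒪,2}`-SEMILINEAR along `(1 + T_i) ↦ u_i (1 + T_i)`**, `u_i = θ(γ_i)θ'(γ_i)⁻¹ = η(γ_i)⁻¹` (same `γ`'s):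
  `Tw (T₁ • x) = (u₁(1 + T₁) − 1) • Tw x`, `Tw (T₂ • x) = (u₂(1 + T₂) − 1) • Tw x`.
* ★★ `twistHom_twistHom` — the twist back (`θ' ⇝ θ`, same thresholds) is a two-sided inverse; ★★★ `twistEquiv : D.H ≃+ D'.H`.
What this gives the junction (BRIEF-E2-g11 rev 5, row «D-tw-coh»): the levelwise coefficient identifications assembled into `D(χ₀).Dᵢ.H ≃+ D(θ*).Dᵢ.H`, semilinear
along `Tw_η`; the transport of the pins `aZeta`/`nsub` (row «D-tw-alg», LEAD) is NOT done here.
DEFS (`twistHom`, `twistEquiv`) + THEOREMS; no named fact, no `sorry`; crux L, crux M, E2 and BSD remain OPEN and are proved for NO curve by any of this.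
References: [Rubin2000] Ch. VI §6.1–6.2 (`Tw_ρ` on `Λ`-modules and Euler systems); [JohnsonLeungKings2011] §4.1–§4.2, Def. 4.2 (94); [Kato2004Asterisque] §8.2.
-/

set_option autoImplicit false
-- the Theorems namespace of this sub repeats the summit name by design (D-0017 nested layout)
set_option linter.dupNamespace false

noncomputable section

open scoped NumberField TensorProduct
open CategoryTheory Field IsDedekindDomain
open Literature.NumberTheory.GaloisRepresentations
open Literature.NumberTheory.GaloisRepresentations.DiscreteGaloisModule
open Literature.NumberTheory.EllipticCurves
open Literature.NumberTheory.ComplexMultiplication.EllipticUnits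
open Literature.NumberTheory.ComplexMultiplication.EllipticUnits.JohnsonLeungKings2011

namespace Summit.BirchSwinnertonDyer.BirchSwinnertonDyer.Theorems.SmallImageRttD2Twist

variable {K : Type} [Field K] [NumberField K] {p : ℕ} [Fact p.Prime] (S : Set (PadicAlgCl p))
  (κ₁ κ₂ : ZpExtension K p) {γ₁ γ₂ γ₁' γ₂' : absoluteGaloisGroup K} (θ θ' : absoluteGaloisGroup K →ₜ* (padicCoeffIntegers S)ˣ)
  (𝔣 : Ideal (𝓞 K)) {i : ℕ} (m : ℕ → ℕ) (hmono : Monotone m)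
  (hN : ∀ k, ∀ σ ∈ ramificationSubgroup K (suppPF p 𝔣), ∃ b : padicCoeffIntegers S,
    ((θ' σ : (padicCoeffIntegers S)ˣ) : padicCoeffIntegers S) = (θ σ : (padicCoeffIntegers S)ˣ) + ((p : padicCoeffIntegers S)) ^ k * b)
  (hm : ∀ k, ∀ σ ∈ JohnsonLeungKings2011.pairLayerSubgroup κ₁ κ₂ (m k), ∃ b : padicCoeffIntegers S,
    ((θ' σ : (padicCoeffIntegers S)ˣ) : padicCoeffIntegers S) = (θ σ : (padicCoeffIntegers S)ˣ) + ((p : padicCoeffIntegers S)) ^ k * b)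
  (D : IwasawaCohomologyDataO S κ₁ κ₂ γ₁ γ₂ θ 𝔣 i) (D' : IwasawaCohomologyDataO S κ₁ κ₂ γ₁' γ₂' θ' 𝔣 i)

include hmono hN hm

/-! ## §1 The assembled twist -/

/-- Through (P3)/(P4) of `D'`: the twisted family of the level components of `x ∈ D.H` IS a unique element of `D'.H`.
[cite: JohnsonLeungKings2011, Def. 4.2 (94) (arXiv p0012:L94)] [cite: Rubin2000, Ch. VI §6.1–6.2] -/
theorem existsUnique_twist (x : D.H) :
    ∃! x' : D'.H, ∀ n k, D'.proj n k x' = twistFamily S κ₁ κ₂ θ θ' 𝔣 m hN hm i (fun n k ↦ D.proj n k x) n k :=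
  D'.exists_unique_of_isCompatibleFamilyO
    (isCompatibleFamilyO_twistFamily S κ₁ κ₂ θ θ' 𝔣 m hN hm hmono i _ (D.isCompatibleFamilyO_proj x))

/-- ★★★ **The assembled twist `Tw : H^i(𝒪_K[1/p𝔣], Λ_𝒪(θ)(1)) → H^i(𝒪_K[1/p𝔣], Λ_𝒪(θ')(1))`** on the pinned data: `x ↦` the unique element of `D'.H` whose level
components are the twisted family of those of `x` (additive by uniqueness). [cite: Rubin2000, Ch. VI §6.1–6.2] [cite: JohnsonLeungKings2011, Def. 4.2 (94) (arXiv p0012:L94)] -/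
def twistHom : D.H →+ D'.H where
  toFun x := (existsUnique_twist S κ₁ κ₂ θ θ' 𝔣 m hmono hN hm D D' x).exists.choose
  map_zero' := by
    refine (existsUnique_twist S κ₁ κ₂ θ θ' 𝔣 m hmono hN hm D D' 0).unique
      (existsUnique_twist S κ₁ κ₂ θ θ' 𝔣 m hmono hN hm D D' 0).exists.choose_spec (fun n k ↦ ?_)
    simp only [twistFamily, map_zero]
  map_add' x y := by
    refine (existsUnique_twist S κ₁ κ₂ θ θ' 𝔣 m hmono hN hm D D' (x + y)).unique
      (existsUnique_twist S κ₁ κ₂ θ θ' 𝔣 m hmono hN hm D D' (x + y)).exists.choose_spec (fun n k ↦ ?_)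
    rw [map_add, (existsUnique_twist S κ₁ κ₂ θ θ' 𝔣 m hmono hN hm D D' x).exists.choose_spec,
      (existsUnique_twist S κ₁ κ₂ θ θ' 𝔣 m hmono hN hm D D' y).exists.choose_spec]
    simp only [twistFamily, map_add]

/-- The level components of `Tw x` are the twisted family. [cite: Rubin2000, Ch. VI §6.1–6.2] -/
theorem proj_twistHom_eq_twistFamily (x : D.H) (n k : ℕ) :
    D'.proj n k (twistHom S κ₁ κ₂ θ θ' 𝔣 m hmono hN hm D D' x) = twistFamily S κ₁ κ₂ θ θ' 𝔣 m hN hm i (fun n k ↦ D.proj n k x) n k :=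
  (existsUnique_twist S κ₁ κ₂ θ θ' 𝔣 m hmono hN hm D D' x).exists.choose_spec n k

/-- ★★ **On the cofinal range `n ≥ m(k)` the level-`(n,k)` component of `Tw x` is the layer twist of that of `x`**: `proj'_{n,k} (Tw x) = tw_n (proj_{n,k} x)`.
[cite: Rubin2000, Ch. VI §6.1–6.2] [cite: JohnsonLeungKings2011, Def. 4.2 (94) (arXiv p0012:L94)] -/
theorem proj_twistHom {n k : ℕ} (hn : m k ≤ n) (x : D.H) :
    D'.proj n k (twistHom S κ₁ κ₂ θ θ' 𝔣 m hmono hN hm D D' x) = layerTwistO S κ₁ κ₂ θ θ' 𝔣 m hN hm n k i hn (D.proj n k x) := by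
  rw [proj_twistHom_eq_twistFamily, twistFamily_eq_layerTwistO S κ₁ κ₂ θ θ' 𝔣 m hN hm i _ (fun n k ↦ D.proj_cores n k x) hn]

/-- The level-`(n,k)` component of `Tw x` at ANY level: `cor_{K̃_M/K̃_n} (tw_M (proj_{M,k} x))` for every `M ≥ n, m(k)`. [cite: Rubin2000, Ch. VI §6.1–6.2] -/
theorem proj_twistHom_eq {n k M : ℕ} (hnM : n ≤ M) (hM : m k ≤ M) (x : D.H) :
    D'.proj n k (twistHom S κ₁ κ₂ θ θ' 𝔣 m hmono hN hm D D' x) =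
      layerCoresLEO S κ₁ κ₂ θ' 𝔣 k i hnM (layerTwistO S κ₁ κ₂ θ θ' 𝔣 m hN hm M k i hM (D.proj M k x)) := by
  rw [proj_twistHom_eq_twistFamily, twistFamily_eq S κ₁ κ₂ θ θ' 𝔣 m hN hm i _ (fun n k ↦ D.proj_cores n k x) hnM hM]

/-- ★ **Uniqueness**: an additive map `D.H → D'.H` whose cofinal level components are the layer twists IS `Tw` (cofinal injectivity of `D'`).
[cite: JohnsonLeungKings2011, Def. 4.2 (94) (arXiv p0012:L94)] -/
theorem twistHom_unique (T : D.H →+ D'.H)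
    (hT : ∀ k n (hn : m k ≤ n) (x : D.H), D'.proj n k (T x) = layerTwistO S κ₁ κ₂ θ θ' 𝔣 m hN hm n k i hn (D.proj n k x)) :
    T = twistHom S κ₁ κ₂ θ θ' 𝔣 m hmono hN hm D D' := by
  ext x
  exact sub_eq_zero.mp (eq_zero_of_proj_eq_zero_of_le D' m _ fun k n hn ↦ by
    rw [map_sub, hT k n hn, proj_twistHom S κ₁ κ₂ θ θ' 𝔣 m hmono hN hm D D' hn, sub_self])

/-! ## §2 Semilinearity -/

/-- ★★ **`Tw` is `𝒪`-linear**: `Tw (c • x) = c • Tw x` for the constants `c ∈ 𝒪 ⊂ Λ_{𝒪,2}` ((P7) on both sides and the `𝒪`-linearity of the layer twists).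
[cite: JohnsonLeungKings2011, §4.1 Def. 4.1 (arXiv p0012:L59–60)] [cite: Rubin2000, Ch. VI §6.1–6.2] -/
theorem twistHom_C_C_smul (c : padicCoeffIntegers S) (x : D.H) :
    twistHom S κ₁ κ₂ θ θ' 𝔣 m hmono hN hm D D'
        ((PowerSeries.C (PowerSeries.C c : PowerSeries (padicCoeffIntegers S)) : IwasawaAlgebraO₂ S) • x) =
      (PowerSeries.C (PowerSeries.C c : PowerSeries (padicCoeffIntegers S)) : IwasawaAlgebraO₂ S) •
        twistHom S κ₁ κ₂ θ θ' 𝔣 m hmono hN hm D D' x :=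
  sub_eq_zero.mp (eq_zero_of_proj_eq_zero_of_le D' m _ fun k n hn ↦ by
    rw [map_sub, proj_twistHom S κ₁ κ₂ θ θ' 𝔣 m hmono hN hm D D' hn, D.proj_C_smul, layerTwistO_layerScalarO, D'.proj_C_smul,
      proj_twistHom S κ₁ κ₂ θ θ' 𝔣 m hmono hN hm D D' hn, sub_self])

/-- **The `T₁`-twist read levelwise** (any `γ`'s on the target datum): `proj'_{n,k} (Tw (T₁ • x)) = u₁ · (γ₁ · tw (proj x)) − tw (proj x)`, `u₁ = θ(γ₁)θ'(γ₁)⁻¹`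
((P5) of `D` and the conj-semilinearity of the layer twists, part 2b). [cite: Rubin2000, Ch. VI §6.1–6.2] [cite: JohnsonLeungKings2011, §4.2 (arXiv p0012:L109–112)] -/
theorem proj_twistHom_X_smul {n k : ℕ} (hn : m k ≤ n) (x : D.H) :
    D'.proj n k (twistHom S κ₁ κ₂ θ θ' 𝔣 m hmono hN hm D D' ((PowerSeries.X : IwasawaAlgebraO₂ S) • x)) =
      layerScalarO S κ₁ κ₂ θ' 𝔣 n k i (((θ γ₁ * (θ' γ₁)⁻¹ : (padicCoeffIntegers S)ˣ)) : padicCoeffIntegers S)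
          (layerConjO S κ₁ κ₂ θ' 𝔣 n k i γ₁ (layerTwistO S κ₁ κ₂ θ θ' 𝔣 m hN hm n k i hn (D.proj n k x))) -
        layerTwistO S κ₁ κ₂ θ θ' 𝔣 m hN hm n k i hn (D.proj n k x) := by
  rw [proj_twistHom S κ₁ κ₂ θ θ' 𝔣 m hmono hN hm D D' hn, D.proj_T₁_smul, map_sub, layerTwistO_layerConjO]

/-- **The `T₂`-twist read levelwise** (any `γ`'s on the target datum): `proj'_{n,k} (Tw (T₂ • x)) = u₂ · (γ₂ · tw (proj x)) − tw (proj x)`, `u₂ = θ(γ₂)θ'(γ₂)⁻¹`.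
[cite: Rubin2000, Ch. VI §6.1–6.2] [cite: JohnsonLeungKings2011, §4.2 (arXiv p0012:L109–112)] -/
theorem proj_twistHom_C_X_smul {n k : ℕ} (hn : m k ≤ n) (x : D.H) :
    D'.proj n k (twistHom S κ₁ κ₂ θ θ' 𝔣 m hmono hN hm D D'
        ((PowerSeries.C (PowerSeries.X : PowerSeries (padicCoeffIntegers S)) : IwasawaAlgebraO₂ S) • x)) =
      layerScalarO S κ₁ κ₂ θ' 𝔣 n k i (((θ γ₂ * (θ' γ₂)⁻¹ : (padicCoeffIntegers S)ˣ)) : padicCoeffIntegers S)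
          (layerConjO S κ₁ κ₂ θ' 𝔣 n k i γ₂ (layerTwistO S κ₁ κ₂ θ θ' 𝔣 m hN hm n k i hn (D.proj n k x))) -
        layerTwistO S κ₁ κ₂ θ θ' 𝔣 m hN hm n k i hn (D.proj n k x) := by
  rw [proj_twistHom S κ₁ κ₂ θ θ' 𝔣 m hmono hN hm D D' hn, D.proj_T₂_smul, map_sub, layerTwistO_layerConjO]

section SameGenerators

variable (D₁ : IwasawaCohomologyDataO S κ₁ κ₂ γ₁ γ₂ θ' 𝔣 i)

/-- ★★★ **`Tw` is semilinear in `T₁` along `(1 + T₁) ↦ u₁ (1 + T₁)`, `u₁ = θ(γ₁)θ'(γ₁)⁻¹`** (target datum pinned by the SAME `γ₁, γ₂`):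
`Tw (T₁ • x) = (u₁ (1 + T₁) − 1) • Tw x` ((P5) on both sides, (P7), and the conj-semilinearity of the layer twists, part 2b).
[cite: Rubin2000, Ch. VI §6.1–6.2] [cite: JohnsonLeungKings2011, §4.2 (arXiv p0012:L109–112)] -/
theorem twistHom_X_smul (x : D.H) :
    twistHom S κ₁ κ₂ θ θ' 𝔣 m hmono hN hm D D₁ ((PowerSeries.X : IwasawaAlgebraO₂ S) • x) =
      ((PowerSeries.C (PowerSeries.C (((θ γ₁ * (θ' γ₁)⁻¹ : (padicCoeffIntegers S)ˣ)) : padicCoeffIntegers S) :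
          PowerSeries (padicCoeffIntegers S)) : IwasawaAlgebraO₂ S) * (1 + PowerSeries.X) - 1) •
        twistHom S κ₁ κ₂ θ θ' 𝔣 m hmono hN hm D D₁ x :=
  sub_eq_zero.mp (eq_zero_of_proj_eq_zero_of_le D₁ m _ fun k n hn ↦ by
    rw [map_sub, sub_eq_zero, proj_twistHom_X_smul S κ₁ κ₂ θ θ' 𝔣 m hmono hN hm D D₁ hn, sub_smul, one_smul, map_sub, mul_smul,
      D₁.proj_C_smul, add_smul, one_smul, map_add, D₁.proj_T₁_smul, proj_twistHom S κ₁ κ₂ θ θ' 𝔣 m hmono hN hm D D₁ hn, add_sub_cancel])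

/-- ★★★ **`Tw` is semilinear in `T₂` along `(1 + T₂) ↦ u₂ (1 + T₂)`, `u₂ = θ(γ₂)θ'(γ₂)⁻¹`** (target datum pinned by the SAME `γ₁, γ₂`):
`Tw (T₂ • x) = (u₂ (1 + T₂) − 1) • Tw x`. [cite: Rubin2000, Ch. VI §6.1–6.2] [cite: JohnsonLeungKings2011, §4.2 (arXiv p0012:L109–112)] -/
theorem twistHom_C_X_smul (x : D.H) :
    twistHom S κ₁ κ₂ θ θ' 𝔣 m hmono hN hm D D₁
        ((PowerSeries.C (PowerSeries.X : PowerSeries (padicCoeffIntegers S)) : IwasawaAlgebraO₂ S) • x) =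
      ((PowerSeries.C (PowerSeries.C (((θ γ₂ * (θ' γ₂)⁻¹ : (padicCoeffIntegers S)ˣ)) : padicCoeffIntegers S) :
          PowerSeries (padicCoeffIntegers S)) : IwasawaAlgebraO₂ S) *
          (1 + (PowerSeries.C (PowerSeries.X : PowerSeries (padicCoeffIntegers S)) : IwasawaAlgebraO₂ S)) - 1) •
        twistHom S κ₁ κ₂ θ θ' 𝔣 m hmono hN hm D D₁ x :=
  sub_eq_zero.mp (eq_zero_of_proj_eq_zero_of_le D₁ m _ fun k n hn ↦ by
    rw [map_sub, sub_eq_zero, proj_twistHom_C_X_smul S κ₁ κ₂ θ θ' 𝔣 m hmono hN hm D D₁ hn, sub_smul, one_smul, map_sub, mul_smul,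
      D₁.proj_C_smul, add_smul, one_smul, map_add, D₁.proj_T₂_smul, proj_twistHom S κ₁ κ₂ θ θ' 𝔣 m hmono hN hm D D₁ hn, add_sub_cancel])

end SameGenerators

/-! ## §3 The twist back is inverse: `Tw` is an isomorphism -/

/-- ★★ **The twist back `θ' ⇝ θ` (same thresholds, hypotheses `congr_symm_forall`) is a left inverse of `Tw`** (cofinal injectivity of `D` and part 1b(i)
`levelTwistO_levelTwistO`). [cite: Rubin2000, Ch. VI §6.1–6.2] [cite: SerreGaloisCohomology1997, I §2.2] -/
theorem twistHom_twistHom (x : D.H) :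
    twistHom S κ₁ κ₂ θ' θ 𝔣 m hmono (fun k ↦ congr_symm_forall S θ θ' k (hN k)) (fun k ↦ congr_symm_forall S θ θ' k (hm k)) D' D
        (twistHom S κ₁ κ₂ θ θ' 𝔣 m hmono hN hm D D' x) = x :=
  sub_eq_zero.mp (eq_zero_of_proj_eq_zero_of_le D m _ fun k n hn ↦ by
    rw [map_sub, proj_twistHom S κ₁ κ₂ θ' θ 𝔣 m hmono _ _ D' D hn, proj_twistHom S κ₁ κ₂ θ θ' 𝔣 m hmono hN hm D D' hn, sub_eq_zero]
    exact levelTwistO_levelTwistO S (suppPF p 𝔣) θ θ' k (hN k) (JohnsonLeungKings2011.pairLayerSubgroup κ₁ κ₂ n)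
      (congr_layer S κ₁ κ₂ θ θ' m hm hn) i (D.proj n k x))

/-- ★★★ **The assembled twist is an additive ISOMORPHISM `H^i(𝒪_K[1/p𝔣], Λ_𝒪(θ)(1)) ≃+ H^i(𝒪_K[1/p𝔣], Λ_𝒪(θ')(1))`** on the pinned data.
[cite: Rubin2000, Ch. VI §6.1–6.2] [cite: JohnsonLeungKings2011, Def. 4.2 (94) (arXiv p0012:L94)] -/
def twistEquiv : D.H ≃+ D'.H :=
  { twistHom S κ₁ κ₂ θ θ' 𝔣 m hmono hN hm D D' with
    invFun := twistHom S κ₁ κ₂ θ' θ 𝔣 m hmono (fun k ↦ congr_symm_forall S θ θ' k (hN k)) (fun k ↦ congr_symm_forall S θ θ' k (hm k)) D' D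
    left_inv := fun x ↦ twistHom_twistHom S κ₁ κ₂ θ θ' 𝔣 m hmono hN hm D D' x
    right_inv := fun x' ↦ twistHom_twistHom S κ₁ κ₂ θ' θ 𝔣 m hmono
      (fun k ↦ congr_symm_forall S θ θ' k (hN k)) (fun k ↦ congr_symm_forall S θ θ' k (hm k)) D' D x' }

/-- Unfolding `twistEquiv`. [cite: Rubin2000, Ch. VI §6.1–6.2] -/
theorem twistEquiv_apply (x : D.H) :
    twistEquiv S κ₁ κ₂ θ θ' 𝔣 m hmono hN hm D D' x = twistHom S κ₁ κ₂ θ θ' 𝔣 m hmono hN hm D D' x := rfl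

end Summit.BirchSwinnertonDyer.BirchSwinnertonDyer.Theorems.SmallImageRttD2Twist

end
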